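import Literature.IUT.HodgeArakelov.BadPrimeGaussianMonoidsCor36Proofs
import Literature.AlgebraicGeometry.Frobenioids.Monoids
import HarnessLib

/-!
# [IUTchII] Definition 3.8 (ii) — proof companion of `TemperedThetaMonoids.lean`: the divisor monoid of the split theta /
# Gaussian monoids is `(ℕ, +)`

S. Mochizuki, *Inter-universal Teichmüller theory II*, §3, kurims Dec-2020 manuscript, Definition 3.8 (ii) p. 113 l. 62 – p. 114
l. 77: «Each of the monoids equipped with a topological group action `G_v(M^Θ_*▶) ↷ Ψ^ι_env(M^Θ_*)`; `G_v(M^Θ_*▶) ↷ Ψ_{†F^Θ_v,α}`;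
`G_v(M^Θ_*▶)_⟨F_l^⋇⟩ ↷ Ψ_ξ(M^Θ_*)`; `G_v(M^Θ_*)_⟨F_l^⋇⟩ ↷ Ψ_{F_ξ}(†F_v)` … gives rise to a `p_v`-adic Frobenioid of monoid type `ℤ` [cf. [FrdII],
Example 1.1, (ii)] … whose divisor monoid associates to every object of `B^temp(G_v(−))⁰` … a monoid isomorphic to `ℕ`»
[cite: Mochizuki2012, Def 3.8 (ii) p.113]. Claim key DISPUTED (D-0012): nothing disputed is asserted. PROOF-ONLY companion
(abc-iut cell, layer L6, seat abc-iut-w4-d019 gen 4, row «IUTchII-COR37-DEF38-COVERAGE»; node **IUTchII:Def3.8(ii)**): NO `def`,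
NO `structure`, NO `instance`, NO new `Prop` fact.

MONOID-LEVEL SHADOW of the printed clause «divisor monoid … isomorphic to `ℕ`»: in [FrdII] Ex 1.1 (ii) the divisor monoid at an
object is the characteristic `M^char = M/M^×` ([FrdI] §0 p. 11; Mathlib `Associates`, abc-iut-L1's `associatesMap`) of the monoid of
invariants; for the split monoids `Ψ = U · θ^ℕ` of [IUTchII] §3 — `Ψ^ι_env(M^Θ_*) = M^×_TM · θ^ℕ` (Prop 3.1 (i),
`TemperedThetaMonoids.ThetaEnvData.thetaMonoid` / `splitMonoid`, abc-iut-L6-t2 p404874), `Ψ_{†F^Θ_v,α} = O^×_{C^Θ_v} · (Θ^α_v)^ℕ` (Ex 3.2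
(i), `frobThetaMonoid`) — with `θ` of infinite order modulo `U` (so that `Ψ^× = U`, abc-iut-w5-d192's `isUnit_splitMonoid_iff`,
p415136), the divisor monoid IS `(ℕ, +)`, the class of `u · θ^n` going to `n` (`exists_associates_splitMonoid_equiv_nat`); divisor
monoids move along monoid isomorphisms (`exists_associates_equiv_of_mulEquiv`), so the same holds for the Gaussian monoids
`Ψ_ξ(M^Θ_*) ≅ Ψ^ι_env(M^Θ_*)` (restriction isomorphism of Cor 3.5 (ii), abc-iut-w4-d004's `exists_unique_restrictionIso_thetaMonoid`
p413958) and `Ψ_{F_ξ}(†F_v)` (Cor 3.6 (ii)/(iii) transport, `exists_kummerRestrictionTransportIso` p412003), generated by the class of the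
value-profile (`exists_associates_equiv_nat_of_mulEquiv_splitMonoid`).
HONEST LIMITS: the `p_v`-adic Frobenioids of Def 3.8 themselves ([FrdII] Ex 1.1 (ii) over the base `B^temp(G_v(−))⁰`) are NOT built
here (abc-iut-L1's `PadicFrd.Datum` is typed over bases of `p`-adic fields); the invariants `Ψ^H` at an open `H ≤ G_v` are again of
the shape `U^H · θ^ℕ` only under the Galois-stability of the splitting, which is the Cor 3.5 (ii)/(iii) material cited above; no
side taken on [IUTchIII] Cor 3.12; typed ≠ proved.
-/

namespace Literature.IUT.HodgeArakelov

namespace TemperedThetaMonoids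

open BadPrimeGaussianMonoids Literature.AlgebraicGeometry.Frobenioids

universe u v w

/-! ### Def 3.8 (ii): the divisor monoid of a split monoid is `(ℕ, +)` -/

section Divisor

/-- Divisor monoids ([FrdI] §0 `M^char = M/M^×`, Mathlib `Associates`) are transported along isomorphisms of monoids: the class map
of abc-iut-L1's `associatesMap` along `e` is an isomorphism (used to move the divisor monoid along the restriction / Kummer /
transport isomorphisms `Ψ^ι_env ⥲ Ψ_ξ ⥲ Ψ_{F_ξ}` of Cor 3.5 (ii), 3.6 (ii), 3.7 (i)). [cite: MochizukiFrdI2008, §0 p.11] -/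
theorem exists_associates_equiv_of_mulEquiv {A B : Type u} [CommMonoid A] [CommMonoid B] (e : A ≃* B) :
    ∃ d : Associates A ≃* Associates B, ∀ a : A, d (Associates.mk a) = Associates.mk (e a) := by
  have hl : Function.LeftInverse (associatesMap e.symm.toMonoidHom) (associatesMap e.toMonoidHom) := by
    intro x
    obtain ⟨a, rfl⟩ := Associates.mk_surjective x
    simp [associatesMap_mk]
  have hr : Function.RightInverse (associatesMap e.symm.toMonoidHom) (associatesMap e.toMonoidHom) := by
    intro y
    obtain ⟨b, rfl⟩ := Associates.mk_surjective y
    simp [associatesMap_mk]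
  exact ⟨MulEquiv.ofBijective (associatesMap e.toMonoidHom) ⟨hl.injective, hr.surjective⟩, fun a => rfl⟩

variable {H : Type u} [CommGroup H] (U : Subgroup H) (θ : H)

/-- **IUTchII:Def3.8(ii)** (kurims p.113 l.76 – p.114 l.1 «a `p_v`-adic Frobenioid of monoid type `ℤ` … whose divisor monoid associates
to every object of `B^temp(G_v(−))⁰` a monoid isomorphic to `ℕ`»), monoid-level shadow: for a split monoid `Ψ = U · θ^ℕ` with `θ` of
infinite order modulo `U` (`Ψ^ι_env(M^Θ_*) = M^×_TM · θ^ℕ`, `Ψ_{†F^Θ_v,α} = O^×_{C^Θ_v} · (Θ^α_v)^ℕ`; Cor 3.6 (iii) `isUnit_splitMonoid_iff`: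
`Ψ^× = U`), the divisor monoid `Ψ/Ψ^×` ([FrdI] §0 `M^char = Associates`) is isomorphic to `(ℕ, +)`, the class of `u · θ^n`
going to `n`. [cite: Mochizuki2012, Def 3.8 (ii) p.113] -/
theorem exists_associates_splitMonoid_equiv_nat (hfree : ∀ n : ℕ, θ ^ n ∈ U → n = 0) :
    ∃ d : Associates (splitMonoid U (Submonoid.powers θ)) ≃* Multiplicative ℕ,
      ∀ (u : H) (hu : u ∈ U) (n : ℕ),
        d (Associates.mk ⟨u * θ ^ n, mul_pow_mem_thetaSplit U θ hu n⟩) = Multiplicative.ofAdd n := by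
  -- the inverse-to-be: `n ↦ class of θ^n`
  set θ' : splitMonoid U (Submonoid.powers θ) := ⟨θ, theta_mem_thetaSplit U θ⟩ with hθ'
  let g : Multiplicative ℕ →* Associates (splitMonoid U (Submonoid.powers θ)) :=
    (Associates.mkMonoidHom).comp (powersHom _ θ')
  have hg : ∀ n : ℕ, g (Multiplicative.ofAdd n) = Associates.mk (θ' ^ n) := fun n => by
    simp [g]
  -- the class of `u · θ^n` is the class of `θ^n` (`u` is a unit OF THE MONOID)
  have hclass : ∀ (u : H) (hu : u ∈ U) (n : ℕ),
      Associates.mk (⟨u * θ ^ n, mul_pow_mem_thetaSplit U θ hu n⟩ : splitMonoid U (Submonoid.powers θ)) =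
        Associates.mk (θ' ^ n) := by
    intro u hu n
    have hunit : IsUnit (⟨u, mem_thetaSplit_of_mem_units U θ hu⟩ : splitMonoid U (Submonoid.powers θ)) :=
      (isUnit_splitMonoid_iff U θ hfree _).mpr hu
    have heq : (⟨u * θ ^ n, mul_pow_mem_thetaSplit U θ hu n⟩ : splitMonoid U (Submonoid.powers θ)) =
        ⟨u, mem_thetaSplit_of_mem_units U θ hu⟩ * θ' ^ n := Subtype.ext (by simp [hθ'])
    rw [heq, Associates.mk_eq_mk_iff_associated]
    exact associated_unit_mul_left _ _ hunit
  have hsurj : Function.Surjective g := by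
    intro y
    obtain ⟨x, rfl⟩ := Associates.mk_surjective y
    obtain ⟨u, hu, n, hx⟩ := exists_eq_unit_mul_theta_pow U θ x
    refine ⟨Multiplicative.ofAdd n, ?_⟩
    rw [hg, hx, Associates.mk_eq_mk_iff_associated]
    exact (associated_unit_mul_left _ _ ((isUnit_splitMonoid_iff U θ hfree _).mpr hu)).symm
  have hinj : Function.Injective g := by
    intro a b hab
    obtain ⟨n, rfl⟩ := Multiplicative.ofAdd.surjective a
    obtain ⟨k, rfl⟩ := Multiplicative.ofAdd.surjective b
    rw [hg, hg, Associates.mk_eq_mk_iff_associated] at hab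
    obtain ⟨w, hw⟩ := hab
    have hwU : ((w : splitMonoid U (Submonoid.powers θ)) : H) ∈ U :=
      (isUnit_splitMonoid_iff U θ hfree _).mp (Units.isUnit w)
    have hH : θ ^ n * ((w : splitMonoid U (Submonoid.powers θ)) : H) = θ ^ k := by
      have := congrArg Subtype.val hw
      simpa [hθ'] using this
    congr 1
    rcases le_total n k with hnk | hkn
    · have h1 : θ ^ (k - n) = ((w : splitMonoid U (Submonoid.powers θ)) : H) := by
        have : θ ^ n * θ ^ (k - n) = θ ^ n * ((w : splitMonoid U (Submonoid.powers θ)) : H) := by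
          rw [← pow_add, Nat.add_sub_cancel' hnk, hH]
        exact mul_left_cancel this
      have := hfree (k - n) (h1 ▸ hwU)
      omega
    · have h1 : θ ^ (n - k) = (((w : splitMonoid U (Submonoid.powers θ)) : H))⁻¹ := by
        have : θ ^ k * (θ ^ (n - k) * ((w : splitMonoid U (Submonoid.powers θ)) : H)) = θ ^ k * 1 := by
          rw [← mul_assoc, ← pow_add, Nat.add_sub_cancel' hkn, hH, mul_one]
        exact eq_inv_of_mul_eq_one_left (mul_left_cancel this)
      have := hfree (n - k) (h1 ▸ U.inv_mem hwU)
      omega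
  refine ⟨(MulEquiv.ofBijective g ⟨hinj, hsurj⟩).symm, fun u hu n => ?_⟩
  rw [MulEquiv.symm_apply_eq, MulEquiv.ofBijective_apply, hg, hclass u hu n]

/-- **IUTchII:Def3.8(ii)** (kurims p.113–114), the same along any monoid isomorphism out of the split monoid — so for the Gaussian
monoids `Ψ_ξ(M^Θ_*)` (restriction isomorphism of Cor 3.5 (ii), `exists_unique_restrictionIso_thetaMonoid`) and `Ψ_{F_ξ}(†F_v)`
(Cor 3.6 (ii)/(iii), Cor 3.7 (i) `cor37_i_chain`): their divisor monoids are `(ℕ, +)`, generated by the class of the image of `θ`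
(the value-profile `ξ`, resp. `Im(ξ)`). [cite: Mochizuki2012, Def 3.8 (ii) p.113] -/
theorem exists_associates_equiv_nat_of_mulEquiv_splitMonoid (hfree : ∀ n : ℕ, θ ^ n ∈ U → n = 0) {B : Type u}
    [CommMonoid B] (e : splitMonoid U (Submonoid.powers θ) ≃* B) :
    ∃ d : Associates B ≃* Multiplicative ℕ,
      ∀ n : ℕ, d (Associates.mk (e ⟨θ, theta_mem_thetaSplit U θ⟩ ^ n)) = Multiplicative.ofAdd n := by
  obtain ⟨d₀, hd₀⟩ := exists_associates_splitMonoid_equiv_nat U θ hfree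
  obtain ⟨c, hc⟩ := exists_associates_equiv_of_mulEquiv e.symm
  refine ⟨c.trans d₀, fun n => ?_⟩
  rw [MulEquiv.trans_apply, hc, ← map_pow, e.symm_apply_apply]
  have h1 : (⟨θ, theta_mem_thetaSplit U θ⟩ : splitMonoid U (Submonoid.powers θ)) ^ n =
      ⟨1 * θ ^ n, mul_pow_mem_thetaSplit U θ U.one_mem n⟩ := Subtype.ext (by simp)
  rw [h1, hd₀ 1 U.one_mem n]

end Divisor

end TemperedThetaMonoids

end Literature.IUT.HodgeArakelov
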